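import Literature.AnabelianGeometry.EtaleTheta.ThetaProperFamilyOfThetaTwistTower
import Literature.AnabelianGeometry.EtaleTheta.TemperedFrobenioidOfThetaTwistTowerSmallIndex
import HarnessLib

/-!
# [EtTh] Def. 4.1 (i) / §5 p.330 at the junction carrier of record (small index): the theta function `Θ̈ ∈ O^×(A^birat)` as a BIRATIONAL UNIT
# over `(A, 0)` for EVERY covering `A` with translation-free stabilisers — e.g. the Ÿ-anchor `(Compat₃′/φ(ιX(Π^tp_Ÿ)), 0)` — and its FRACTION-PAIR

S. Mochizuki, *The étale theta function and its Frobenioid-theoretic manifestations*, Publ. RIMS **45** (2009) [MochizukiEtTh2009], Def. 3.6 (i)(ii)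
pp.302–303 (PDF pp.76–77), Def. 4.1 (i) p.312 (PDF p.86) (fraction-pairs), Prop. 1.4 (i) p.247 (PDF p.21), §5 p.330 (PDF p.104) («the theta
function determines an element of `O^×(A_⊙^birat)`», `A_⊙^bs` the `Ÿ`-covering); [FrdI] = [MochizukiFrdI2008] Thm. 5.2 (i)(ii) pp.100–101,
Prop. 4.1 (iii) p.74; [FrdII] = [MochizukiFrdII2008] Ex. 1.3 (i) p.11.  [cite: MochizukiEtTh2009, Def 4.1 (i) p.86]
PAGE CONVENTION for [EtTh]: «printed N (PDF p.M)», N = M + 226.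

CLASS (b) DATUM (definitions + theorems; abc-iut cell, layer L2, seat abc-iut-L2-d2 gen 8; plan/L2/SUBDAG-EtTh-JUNCTION.md slot D5 at abc-iut-L2-t3's
junction carrier of record `ThetaTwistTowerSmallIndex.temperedFrobenioidSmall` / `settingSmallYdd` (p501267, p504077); FILE D2 over D1
`ThetaProperFamilyOfThetaTwistTower`).  The twin of this seat's FILE A2 (`ThetaFractionPairOfThetaTwistTower`, p507274: the level-`n` ROOT over
`Compat₃′/V_n` at FILE 4's socket) with THREE differences: the model is the small-index re-indexing (data of a covering `A` = FILE 4's data at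
the coset re-presentation `repr A`), the covering `A` is ARBITRARY with translation-free stabilisers (hypothesis `hA`), and the function is `Θ̈`
PROPER (`thetaProper = Θ̈_m^{N_m}`), which such stabilisers fix with NO Kummer-class condition.  Consumed BY NAME, nothing restated: D1
(`thetaProperFam`, `thetaPolesFamOf`, `thetaZerosFamOf`, `divZeroHom_thetaProperFam`, `perfection_coprime_thetaZerosFamOf_pow`), abc-iut-L2-t3's
`temperedFrobenioidSmall` / `dmSmall` / `hpfSmall` / `powDiagonalBaseSmall` / `repr` / `reprIso` / `hPSmall` / `quotConnObj`, [FrdI] plumbing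
`ModelFrobenioid.mkHom` / `zeroObj`, abc-iut-L2-t9's `mkOfModelCanonical` vocabulary, abc-iut-L6-t12's `coe_fracOfModel_mul_unit`,
abc-iut-w6-d037's `PowDiagonalBase.dvd_of_toRealification_dvd`.
* §1 translation-free coverings: `pt A` (a point of `gset (repr A)`), the hypothesis shape `TranslationFree A := ∀ s g, g·s = s → φ₃ g = 1` is NOT
  a definition here (spelled out in every binder); **`translationFree_repr_quotConnObj`** — it HOLDS for `A := Compat₃′/M` whenever
  `M ≤ Ker φ₃` (e.g. the Ÿ-anchor `M_Y = φ(ιX(Π^tp_Ÿ))` under the junction's display clause «`φ₃ ∘ φ ∘ ιX = 1` on `Π^tp_Ÿ`»).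
* §2 at the covering's own data (FILE 4 at `repr A`, level `lvl (repr A)`): `ιΦSmall : Φ₀(repr A) →* Φ(A)`, the classes **`thetaZerosΦSmall`**,
  **`thetaPolesΦSmall`** (the `N_m`-th powers of the cusp / `D₁` families) with **`coprime_thetaZerosΦSmall_thetaPolesΦSmall`**,
  **`thetaProperRatFn ∈ B(A)`** = (`Θ̈`, `ι^gp(div₀ Θ̈)`), `Div_B Θ̈ = [ι zeros^{N_m}] − [ι poles^{N_m}]`.
* §3 **`AzeroSmall A = (A, 0)`**, **`thetaProperUnit : O^×((A,0)^birat)`**, codomain `(A, [ι poles^{N_m}])`, pre-steps **`thetaProperNum =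
  (1, id, ι zeros^{N_m}, Θ̈)`**, **`thetaProperDen = (1, id, ι poles^{N_m}, 1)`**, and **`thetaProperFractionPair`** — a `FractionPair` of EVERY
  canonical §4 instance `mkOfModelCanonical X (temperedFrobenioidSmall R S) rfl (hPSmall R S) IG gS gSs NH A₀ hA₀ hA₀'` at `K : Type 0` —
  verbatim at `settingSmall … M` / `settingSmallYdd …` (= `mkOfQuotientTemperoidQuot … M` with anchor `(Compat₃′/M, 0)`).
HONEST FRAMING: class-(b) combinatorial DESIGN carrier (NOT the tempered Frobenioid of a Tate curve; (β) sign deviation of record); the junction's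
group-side hypotheses (`φ` onto — design-only per R1257; the display clauses) are NOT touched; roots of this fraction-pair need a Prop. 4.2 (iii)
instance at the small-index model (none in the tree yet); no Prop-valued fact, no instance, no notation, no sorry; nothing here bears on
[IUTchIII] Cor. 3.12; no side taken; typed ≠ proved.
-/

noncomputable section

namespace Literature.AnabelianGeometry.EtaleTheta

open CategoryTheory Opposite Function Literature.AlgebraicGeometry.Frobenioids Literature.AlgebraicGeometry.Frobenioids.QuasiTemperoid
  Literature.AlgebraicGeometry.Frobenioids.QuasiTemperoid.BTempConnected Literature.AnabelianGeometry.SemiGraphs LogDivisorModel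
  LogDivisorModel.GaloisAction LogDivisorTower TateTowerKummerTwistRShear LogDivisorModel.TateTowerThetaTwist

namespace ThetaTwistTowerSmallIndex

open ThetaTwistTowerTempered
open TateTowerKummerTwist (N)

/-! ## §1 Coverings with translation-free stabilisers -/

/-- A chosen point of the `Compat₃′`-set of the coset re-presentation of a covering. [cite: MochizukiFrdII2008, Ex 1.3 (i) p.11] -/
def pt (A : ConnectedPart (BTemp (Compat 3 thetaShear))) : (gset (repr A)).V := (isConnectedGSet_gset (repr A)).1.some

/-- **The quotient covering `Compat₃′/M` by an open normal `M ≤ Ker φ₃` has TRANSLATION-FREE stabilisers on its coset re-presentation**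
(every stabiliser of `Compat₃′/M` is `M` by normality; the re-presentation is `Compat₃′`-isomorphic to it).  At the Ÿ-anchor `M := φ(ιX(Π^tp_Ÿ))`
of abc-iut-L2-t3's `settingSmallYdd` this is the junction's display clause «`φ₃ ∘ φ ∘ ιX = 1` on `Π^tp_Ÿ`». [cite: MochizukiEtTh2009, §5 p.330 (PDF p.104)] -/
theorem translationFree_repr_quotConnObj (M : OpenNormalSubgroup (Compat 3 thetaShear)) (hM : ∀ g ∈ M.toSubgroup, φ₃ g = 1)
    (s : (gset (repr (TemperedFrobenioid.quotConnObj isTempered_compat₃' M))).V) (g : Compat 3 thetaShear)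
    (hg : (gset (repr (TemperedFrobenioid.quotConnObj isTempered_compat₃' M))).ρ g s = s) : φ₃ g = 1 := by
  -- transport the fixed point along the coset re-presentation `repr A ≅ A`, then read the stabiliser in `Compat₃′/M`
  have e := hom_ρ (reprIso (TemperedFrobenioid.quotConnObj isTempered_compat₃' M)).hom.hom g s
  rw [hg] at e
  obtain ⟨a, ha⟩ := QuotientGroup.mk_surjective
    (((reprIso (TemperedFrobenioid.quotConnObj isTempered_compat₃' M)).hom.hom.hom.hom s :
      (TemperedFrobenioid.quotConnObj isTempered_compat₃' M).obj.obj.V))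
  have e' : (Action.ofMulAction (Compat 3 thetaShear) (Compat 3 thetaShear ⧸ M.toSubgroup)).ρ g (a : Compat 3 thetaShear ⧸ M.toSubgroup) =
      (a : Compat 3 thetaShear ⧸ M.toSubgroup) := by
    have e2 := e.symm
    rw [← ha] at e2
    exact e2
  have hmem : a⁻¹ * g * a ∈ M.toSubgroup := (ofMulAction_quot_fix_iff₃ M.toSubgroup a g).1 e'
  have hφ : φ₃ (a⁻¹ * g * a) = 1 := hM _ hmem
  rwa [map_mul, map_mul, map_inv, mul_right_comm, inv_mul_cancel, one_mul] at hφ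

variable (R S : ((ConnectedPart (BTemp (Compat 3 thetaShear)))ᵒᵖ ⥤ CommMonCat.{0}) → Prop) (A : ConnectedPart (BTemp (Compat 3 thetaShear)))
  (hA : ∀ (s : (gset (repr A)).V) (g : Compat 3 thetaShear), (gset (repr A)).ρ g s = s → φ₃ g = 1)

/-! ## §2 The classes of the two divisors in `Φ(A)` and the theta function in `B(A)` (small index: FILE 4's data at `repr A`) -/

/-- `ι : Φ₀(repr A) → Φ(A) = im(Φ₀^pf → Φ₀^rlf)`, the class map of the small-index model at a covering `A`. [cite: MochizukiEtTh2009, Def 3.6 p.77] -/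
def ιΦSmall : dmSmall.Φ₀.obj (op (equivConn.inverse.obj A)) →* (temperedFrobenioidSmall R S).divisorMonoid.obj (op A) :=
  (hpfSmall (op (equivConn.inverse.obj A))).weak.toRealification.mrangeRestrict.comp (Perfection.of _)

/-- `ι` on elements. [cite: MochizukiEtTh2009, Def 3.6 p.77] -/
theorem coe_ιΦSmall (ψ : dmSmall.Φ₀.obj (op (equivConn.inverse.obj A))) :
    (ιΦSmall R S A ψ).1 = (hpfSmall (op (equivConn.inverse.obj A))).weak.toRealification (Perfection.of _ ψ) := rfl

/-- `ι` IS the Def. 3.6 (i) map `Φ₀ → Φ₀^ℝ` of the weak data followed by the inclusion `Φ(A) ⊆ Φ₀^ℝ(A)` (pointwise definitional).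
[cite: MochizukiEtTh2009, Def 3.6 p.76] -/
theorem subtype_comp_ιΦSmall :
    ((temperedFrobenioidSmall R S).Φ.carrier (op A)).subtype.comp (ιΦSmall R S A) =
      ((toRlfNatTransWeak dmSmall.Φ₀ hpfSmall).app (op (equivConn.inverse.obj A))).hom :=
  MonoidHom.ext fun _ => rfl

/-- **`Θ̈` in `B₀(A)` of the small-index data** (= D1's `thetaProperFam` on `gset (repr A)` at the covering's own level). [cite: MochizukiEtTh2009, Def 3.3 (iii) p.73] -/
def thetaProperB₀ : dmSmall.B₀.obj (op (equivConn.inverse.obj A)) :=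
  thetaProperFam (isConnectedGSet_gset (repr A)) (pt A) (hA (pt A)) (lvlC 3 thetaShear (repr A))

/-- The `N_m`-th power of the cusp family, in `Φ₀(A)`. [cite: MochizukiEtTh2009, Prop 1.4 p.21] -/
def thetaZerosPowΦ₀ : dmSmall.Φ₀.obj (op (equivConn.inverse.obj A)) :=
  thetaZerosFamOf (gset (repr A)) (lvlC 3 thetaShear (repr A)) ^ ((N (lvlC 3 thetaShear (repr A)) : ℕ+) : ℕ)

/-- The `N_m`-th power of the `D₁`-family, in `Φ₀(A)`. [cite: MochizukiEtTh2009, Prop 1.4 p.21] -/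
def thetaPolesPowΦ₀ : dmSmall.Φ₀.obj (op (equivConn.inverse.obj A)) :=
  thetaPolesFamOf (isConnectedGSet_gset (repr A)) (pt A) (hA (pt A)) (lvlC 3 thetaShear (repr A)) ^ ((N (lvlC 3 thetaShear (repr A)) : ℕ+) : ℕ)

/-- `div₀ Θ̈ = [zeros^{N_m}]/[poles^{N_m}]` in the data's `Φ₀(A)^gp`. [cite: MochizukiEtTh2009, Def 3.3 (iii) p.73] -/
theorem div₀_thetaProperB₀ : dmSmall.div₀ (op (equivConn.inverse.obj A)) (thetaProperB₀ A hA) =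
    Algebra.GrothendieckGroup.of (thetaZerosPowΦ₀ A) / Algebra.GrothendieckGroup.of (thetaPolesPowΦ₀ A hA) :=
  divZeroHom_thetaProperFam _ _ _ _

/-- Product form. [cite: MochizukiEtTh2009, Def 3.3 (iii) p.73] -/
theorem div₀_thetaProperB₀_mul : dmSmall.div₀ (op (equivConn.inverse.obj A)) (thetaProperB₀ A hA) * Algebra.GrothendieckGroup.of (thetaPolesPowΦ₀ A hA) =
    Algebra.GrothendieckGroup.of (thetaZerosPowΦ₀ A) :=
  eq_div_iff_mul_eq'.mp (div₀_thetaProperB₀ A hA)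

/-- The two classes are coprime in `Φ₀(A)^pf`. [cite: MochizukiEtTh2009, Def 4.1 (i) p.86] -/
theorem perfection_coprime_thetaZerosPowΦ₀ (ξ : Perfection (dmSmall.Φ₀.obj (op (equivConn.inverse.obj A))))
    (hz : ξ ∣ Perfection.of _ (thetaZerosPowΦ₀ A)) (hp : ξ ∣ Perfection.of _ (thetaPolesPowΦ₀ A hA)) : ξ = 1 :=
  perfection_coprime_thetaZerosFamOf_pow _ _ _ _ ξ hz hp

/-- **The class of the ZERO divisor of `Θ̈` in `Φ(A)`.** [cite: MochizukiEtTh2009, Def 4.1 (i) p.87] -/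
def thetaZerosΦSmall : (temperedFrobenioidSmall R S).divisorMonoid.obj (op A) := ιΦSmall R S A (thetaZerosPowΦ₀ A)

/-- **The class of the POLAR divisor of `Θ̈` in `Φ(A)`.** [cite: MochizukiEtTh2009, Def 4.1 (i) p.87] -/
def thetaPolesΦSmall : (temperedFrobenioidSmall R S).divisorMonoid.obj (op A) := ιΦSmall R S A (thetaPolesPowΦ₀ A hA)

/-- **Disjoint supports** ([FrdI] Prop. 4.1 (iii) coprimality form): every common divisor in `Φ(A)` of the two classes is trivial.
[cite: MochizukiEtTh2009, Def 4.1 (i) p.86] -/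
theorem coprime_thetaZerosΦSmall_thetaPolesΦSmall (x : (temperedFrobenioidSmall R S).divisorMonoid.obj (op A))
    (hz : x ∣ thetaZerosΦSmall R S A) (hp : x ∣ thetaPolesΦSmall R S A hA) : x = 1 := by
  obtain ⟨ξ, hξ⟩ := x.2
  have hz' := TemperedFrobenioid.PowDiagonalBase.dvd_of_toRealification_dvd hpfSmall powDiagonalBaseSmall _ _ _ R S (op A) ξ
    (Perfection.of _ (thetaZerosPowΦ₀ A)) x (thetaZerosΦSmall R S A) hξ rfl hz
  have hp' := TemperedFrobenioid.PowDiagonalBase.dvd_of_toRealification_dvd hpfSmall powDiagonalBaseSmall _ _ _ R S (op A) ξ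
    (Perfection.of _ (thetaPolesPowΦ₀ A hA)) x (thetaPolesΦSmall R S A hA) hξ rfl hp
  have h1 : ξ = 1 := perfection_coprime_thetaZerosPowΦ₀ A hA ξ hz' hp'
  apply Subtype.ext
  rw [← hξ, h1]
  exact map_one _

/-- **`Div_B(Θ̈) ∈ Φ(A)^gp`**: the image of `div₀ Θ̈` under `ι^gp`. [cite: MochizukiEtTh2009, Def 4.1 (i) p.87] -/
def thetaProperDivB : Algebra.GrothendieckGroup ((temperedFrobenioidSmall R S).divisorMonoid.obj (op A)) :=
  EtaleTheta.gpMap (ιΦSmall R S A) (dmSmall.div₀ (op (equivConn.inverse.obj A)) (thetaProperB₀ A hA))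

/-- **`Div_B(Θ̈) · [ι poles^{N_m}] = [ι zeros^{N_m}]`.** [cite: MochizukiEtTh2009, Def 4.1 (i) p.87] -/
theorem thetaProperDivB_mul_of_thetaPolesΦSmall :
    thetaProperDivB R S A hA * Algebra.GrothendieckGroup.of (thetaPolesΦSmall R S A hA) = Algebra.GrothendieckGroup.of (thetaZerosΦSmall R S A) := by
  have e1 : EtaleTheta.gpMap (ιΦSmall R S A) (Algebra.GrothendieckGroup.of (thetaPolesPowΦ₀ A hA)) =
      Algebra.GrothendieckGroup.of (thetaPolesΦSmall R S A hA) := EtaleTheta.gpMap_of _ _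
  have e2 : EtaleTheta.gpMap (ιΦSmall R S A) (Algebra.GrothendieckGroup.of (thetaZerosPowΦ₀ A)) =
      Algebra.GrothendieckGroup.of (thetaZerosΦSmall R S A) := EtaleTheta.gpMap_of _ _
  have e3 := (EtaleTheta.gpMap (ιΦSmall R S A)).map_mul (dmSmall.div₀ (op (equivConn.inverse.obj A)) (thetaProperB₀ A hA))
    (Algebra.GrothendieckGroup.of (thetaPolesPowΦ₀ A hA))
  exact (congrArg (thetaProperDivB R S A hA * ·) e1.symm).trans
    (e3.symm.trans ((congrArg (EtaleTheta.gpMap (ιΦSmall R S A)) (div₀_thetaProperB₀_mul A hA)).trans e2))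

/-- Quotient form: `Div_B(Θ̈) = [ι zeros^{N_m}] / [ι poles^{N_m}]`. [cite: MochizukiEtTh2009, Def 4.1 (i) p.87] -/
theorem thetaProperDivB_eq_div :
    thetaProperDivB R S A hA = Algebra.GrothendieckGroup.of (thetaZerosΦSmall R S A) / Algebra.GrothendieckGroup.of (thetaPolesΦSmall R S A hA) :=
  eq_div_iff_mul_eq'.mpr (thetaProperDivB_mul_of_thetaPolesΦSmall R S A hA)

/-- The pair (`Θ̈`, `Div_B(Θ̈)`) lies in `B(A) = B₀(A) ×_{(Φ^rlf)^gp} Φ(A)^gp` (functoriality of `(−)^gp` along `Φ₀ → Φ ⊆ Φ₀^ℝ`).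
[cite: MochizukiEtTh2009, Def 3.6 p.77] -/
theorem thetaProperRatFn_mem :
    ((thetaProperB₀ A hA, thetaProperDivB R S A hA) :
        ((RealifiedDivisorMonoids.ofRlfZWeak dmSmall hpfSmall).BΛ.obj ((temperedFrobenioidSmall R S).baseOp (op A)) : Type) ×
          Algebra.GrothendieckGroup ((temperedFrobenioidSmall R S).Φ.carrier (op A))) ∈
      (temperedFrobenioidSmall R S).ratFn (op A) := by
  change EtaleTheta.gpMap ((toRlfNatTransWeak dmSmall.Φ₀ hpfSmall).app (op (equivConn.inverse.obj A))).hom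
      (dmSmall.div₀ (op (equivConn.inverse.obj A)) (thetaProperB₀ A hA)) =
    EtaleTheta.gpMap ((temperedFrobenioidSmall R S).Φ.carrier (op A)).subtype
      (EtaleTheta.gpMap (ιΦSmall R S A) (dmSmall.div₀ (op (equivConn.inverse.obj A)) (thetaProperB₀ A hA)))
  exact ((congrArg (fun F => EtaleTheta.gpMap F (dmSmall.div₀ (op (equivConn.inverse.obj A)) (thetaProperB₀ A hA)))
    (subtype_comp_ιΦSmall R S A)).symm.trans (gpMap_comp_apply'' _ _ _))

/-- **`Θ̈ ∈ B(A)`** — the theta function as a rational function of the small-index model at the covering `A`. [cite: MochizukiEtTh2009, §5 p.330] -/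
def thetaProperRatFn : (temperedFrobenioidSmall R S).ratFnFunctor.obj (op A) := ⟨_, thetaProperRatFn_mem R S A hA⟩

/-- Its function component is `Θ̈` (definitionally). [cite: MochizukiEtTh2009, Def 3.6 p.77] -/
theorem thetaProperRatFn_fst : (thetaProperRatFn R S A hA).1.1 = thetaProperB₀ A hA := rfl

/-- `Div_B` of the rational function is `Div_B(Θ̈)` (definitionally). [cite: MochizukiEtTh2009, Def 4.1 (i) p.87] -/
theorem divB_thetaProperRatFn :
    Literature.AlgebraicGeometry.Frobenioids.divB (temperedFrobenioidSmall R S).divisorMonoid (temperedFrobenioidSmall R S).ratFnFunctor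
        (temperedFrobenioidSmall R S).divBNatTrans (op A) (thetaProperRatFn R S A hA) = thetaProperDivB R S A hA := rfl

/-! ## §3 The object `(A, 0)`, the birational unit `Θ̈ ∈ O^×((A,0)^birat)` and its FRACTION-PAIR -/

/-- **`(A, 0)`** — the Frobenius-trivial object of the small-index model over `A` ([FrdI] Thm. 5.2 (i); for `A = Compat₃′/M` it IS abc-iut-L2-t3's
`quotConnZeroObj isTempered_compat₃' M`, the anchor of `settingSmall … M` / `settingSmallYdd`, see `AzeroSmall_quotConnObj`). [cite: MochizukiEtTh2009, Def 4.1 p.86] -/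
abbrev AzeroSmall : (temperedFrobenioidSmall R S).category :=
  ModelFrobenioid.zeroObj (temperedFrobenioidSmall R S).divisorMonoid (temperedFrobenioidSmall R S).ratFnFunctor
    (temperedFrobenioidSmall R S).divBNatTrans A

/-- `(Compat₃′/M, 0)` IS the anchor object of abc-iut-L2-t3's quotient sockets (definitionally). [cite: MochizukiEtTh2009, Def 4.1 p.86] -/
theorem AzeroSmall_quotConnObj (M : OpenNormalSubgroup (Compat 3 thetaShear)) :
    AzeroSmall R S (TemperedFrobenioid.quotConnObj isTempered_compat₃' M) =
      (temperedFrobenioidSmall R S).quotConnZeroObj isTempered_compat₃' M := rfl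

/-- `(A, 0)^bs = A` (definitionally). [cite: MochizukiEtTh2009, Def 4.1 p.86] -/
theorem AzeroSmall_base : (AzeroSmall R S A).base = A := rfl

/-- **`Θ̈ ∈ O^×((A,0)^birat) = B(A)^×`** (§5 p.330; `B` group-like). [cite: MochizukiEtTh2009, §5 p.330] -/
def thetaProperUnit : (temperedFrobenioidSmall R S).biratUnitsModel (AzeroSmall R S A) :=
  ((temperedFrobenioidSmall R S).isUnit_ratFnFunctor (RealifiedDivisorMonoids.ofRlfZWeak dmSmall hpfSmall).isUnit_BΛ
    (AzeroSmall R S A) (thetaProperRatFn R S A hA)).unit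

/-- The underlying element of `B(A)` of the unit is `Θ̈`. [cite: MochizukiEtTh2009, §5 p.330] -/
theorem coe_thetaProperUnit :
    ((thetaProperUnit R S A hA : (temperedFrobenioidSmall R S).biratUnitsModel (AzeroSmall R S A)) :
        (temperedFrobenioidSmall R S).ratFnFunctor.obj (op (AzeroSmall R S A).base)) = thetaProperRatFn R S A hA :=
  IsUnit.unit_spec _

/-- **The codomain `(A, [ι D₁^{N_m}])`** of the fraction-pair. [cite: MochizukiEtTh2009, Def 4.1 (i) p.86] -/
abbrev thetaProperCod : (temperedFrobenioidSmall R S).category := ⟨A, Algebra.GrothendieckGroup.of (thetaPolesΦSmall R S A hA)⟩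

/-- Relation (d) of [FrdI] Thm. 5.2 (i) for the numerator. [cite: MochizukiFrdI2008, Thm. 5.2 p.100] -/
theorem rel_thetaProperNum :
    (1 : Algebra.GrothendieckGroup ((temperedFrobenioidSmall R S).divisorMonoid.obj (op A))) ^ ((1 : ℕ+) : ℕ) *
        Algebra.GrothendieckGroup.of (thetaZerosΦSmall R S A) =
    pullGp (temperedFrobenioidSmall R S).divisorMonoid (𝟙 A) (Algebra.GrothendieckGroup.of (thetaPolesΦSmall R S A hA)) *
      Literature.AlgebraicGeometry.Frobenioids.divB (temperedFrobenioidSmall R S).divisorMonoid (temperedFrobenioidSmall R S).ratFnFunctor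
        (temperedFrobenioidSmall R S).divBNatTrans (op A) (thetaProperRatFn R S A hA) := by
  rw [one_pow, one_mul, pullGp_id, divB_thetaProperRatFn, mul_comm]
  exact (thetaProperDivB_mul_of_thetaPolesΦSmall R S A hA).symm

/-- Relation (d) of [FrdI] Thm. 5.2 (i) for the denominator. [cite: MochizukiFrdI2008, Thm. 5.2 p.100] -/
theorem rel_thetaProperDen :
    (1 : Algebra.GrothendieckGroup ((temperedFrobenioidSmall R S).divisorMonoid.obj (op A))) ^ ((1 : ℕ+) : ℕ) *
        Algebra.GrothendieckGroup.of (thetaPolesΦSmall R S A hA) =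
    pullGp (temperedFrobenioidSmall R S).divisorMonoid (𝟙 A) (Algebra.GrothendieckGroup.of (thetaPolesΦSmall R S A hA)) *
      Literature.AlgebraicGeometry.Frobenioids.divB (temperedFrobenioidSmall R S).divisorMonoid (temperedFrobenioidSmall R S).ratFnFunctor
        (temperedFrobenioidSmall R S).divBNatTrans (op A) 1 := by
  rw [one_pow, one_mul, pullGp_id, map_one, mul_one]

/-- **The numerator pre-step `s′ := (1, id, ι zeros^{N_m}, Θ̈) : (A,0) → (A, [ι D₁^{N_m}])`.** [cite: MochizukiEtTh2009, Def 4.1 (i) p.86] -/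
def thetaProperNum : AzeroSmall R S A ⟶ thetaProperCod R S A hA :=
  ModelFrobenioid.mkHom (AzeroSmall R S A) (thetaProperCod R S A hA) 1 (𝟙 A) (thetaZerosΦSmall R S A) (thetaProperRatFn R S A hA)
    (rel_thetaProperNum R S A hA)

/-- **The denominator pre-step `s″ := (1, id, ι poles^{N_m}, 1)`.** [cite: MochizukiEtTh2009, Def 4.1 (i) p.86] -/
def thetaProperDen : AzeroSmall R S A ⟶ thetaProperCod R S A hA :=
  ModelFrobenioid.mkHom (AzeroSmall R S A) (thetaProperCod R S A hA) 1 (𝟙 A) (thetaPolesΦSmall R S A hA) 1 (rel_thetaProperDen R S A hA)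

/-- `Div(s′)`. [cite: MochizukiEtTh2009, Def 4.1 (i) p.87] -/
@[simp] theorem div_thetaProperNum : ModelFrobenioid.div (thetaProperNum R S A hA) = thetaZerosΦSmall R S A := ModelFrobenioid.div_mkHom _ _ _ _ _

/-- `Div(s″)`. [cite: MochizukiEtTh2009, Def 4.1 (i) p.87] -/
@[simp] theorem div_thetaProperDen : ModelFrobenioid.div (thetaProperDen R S A hA) = thetaPolesΦSmall R S A hA :=
  ModelFrobenioid.div_mkHom _ _ _ _ _

/-- `u_{s′} = Θ̈`. [cite: MochizukiEtTh2009, Def 4.1 (i) p.86] -/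
@[simp] theorem unit_thetaProperNum : ModelFrobenioid.unit (thetaProperNum R S A hA) = thetaProperRatFn R S A hA :=
  ModelFrobenioid.unit_mkHom _ _ _ _ _

/-- `u_{s″} = 1`. [cite: MochizukiEtTh2009, Def 4.1 (i) p.86] -/
@[simp] theorem unit_thetaProperDen : ModelFrobenioid.unit (thetaProperDen R S A hA) = 1 := ModelFrobenioid.unit_mkHom _ _ _ _ _

/-- `Base(s′) = id`. [cite: MochizukiEtTh2009, Def 4.1 (i) p.86] -/
@[simp] theorem baseMap_thetaProperNum : ModelFrobenioid.baseMap (thetaProperNum R S A hA) = 𝟙 A := ModelFrobenioid.baseMap_mkHom _ _ _ _ _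

/-- `Base(s″) = id`. [cite: MochizukiEtTh2009, Def 4.1 (i) p.86] -/
@[simp] theorem baseMap_thetaProperDen : ModelFrobenioid.baseMap (thetaProperDen R S A hA) = 𝟙 A := ModelFrobenioid.baseMap_mkHom _ _ _ _ _

/-- `deg_Fr(s′) = 1`. [cite: MochizukiEtTh2009, Def 4.1 (i) p.86] -/
@[simp] theorem degFr_thetaProperNum : ModelFrobenioid.degFr (thetaProperNum R S A hA) = 1 := ModelFrobenioid.degFr_mkHom _ _ _ _ _

/-- `deg_Fr(s″) = 1`. [cite: MochizukiEtTh2009, Def 4.1 (i) p.86] -/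
@[simp] theorem degFr_thetaProperDen : ModelFrobenioid.degFr (thetaProperDen R S A hA) = 1 := ModelFrobenioid.degFr_mkHom _ _ _ _ _

/-- `s′` is a pre-step. [cite: MochizukiEtTh2009, Def 4.1 (i) p.86] -/
theorem isPreStep_thetaProperNum : PreFrobenioid.IsPreStep (temperedFrobenioidSmall R S).toElem (thetaProperNum R S A hA) :=
  ⟨degFr_thetaProperNum R S A hA, by
    show IsIso (ModelFrobenioid.baseMap (thetaProperNum R S A hA)); rw [baseMap_thetaProperNum]; exact IsIso.id _⟩

/-- `s″` is a pre-step. [cite: MochizukiEtTh2009, Def 4.1 (i) p.86] -/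
theorem isPreStep_thetaProperDen : PreFrobenioid.IsPreStep (temperedFrobenioidSmall R S).toElem (thetaProperDen R S A hA) :=
  ⟨degFr_thetaProperDen R S A hA, by
    show IsIso (ModelFrobenioid.baseMap (thetaProperDen R S A hA)); rw [baseMap_thetaProperDen]; exact IsIso.id _⟩

/-- `s′`, `s″` are base-equivalent. [cite: MochizukiEtTh2009, Def 4.1 (i) p.86] -/
theorem baseEquivalent_thetaProperNum_thetaProperDen :
    PreFrobenioid.BaseEquivalent (temperedFrobenioidSmall R S).toElem (thetaProperNum R S A hA) (thetaProperDen R S A hA) := by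
  change ModelFrobenioid.baseMap (thetaProperNum R S A hA) = ModelFrobenioid.baseMap (thetaProperDen R S A hA)
  rw [baseMap_thetaProperNum, baseMap_thetaProperDen]

/-- **`s′ · (s″)⁻¹ = Θ̈` in `O^×((A,0)^birat)`.** [cite: MochizukiEtTh2009, Def 4.1 (i) p.86] -/
theorem fracOfModel_thetaProperNum_thetaProperDen :
    (temperedFrobenioidSmall R S).fracOfModel (RealifiedDivisorMonoids.ofRlfZWeak dmSmall hpfSmall).isUnit_BΛ
        (thetaProperNum R S A hA) (thetaProperDen R S A hA) = thetaProperUnit R S A hA := by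
  apply Units.ext
  have h := BiKummerSetting.coe_fracOfModel_mul_unit (temperedFrobenioidSmall R S)
    (RealifiedDivisorMonoids.ofRlfZWeak dmSmall hpfSmall).isUnit_BΛ (thetaProperNum R S A hA) (thetaProperDen R S A hA)
  rw [unit_thetaProperDen, mul_one, unit_thetaProperNum] at h
  rw [h, coe_thetaProperUnit]

variable {K : Type} [Field K] (X : SemiGraphs.TemperedArithmeticGroup.{0} K) (IG : ConnectedPart (BTemp (Compat 3 thetaShear)) → Prop)
  (gS : ∀ B : ConnectedPart (BTemp (Compat 3 thetaShear)), IG B → (X.Pi →* Aut B))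
  (gSs : ∀ (B : ConnectedPart (BTemp (Compat 3 thetaShear))) (h : IG B), Function.Surjective (gS B h))
  (NH : Subgroup (Field.absoluteGaloisGroup K) → (temperedFrobenioidSmall R S).category → ℕ+ → Prop)
  (A₀ : (temperedFrobenioidSmall R S).category)
  (hA₀ : PreFrobenioid.IsFrobeniusTrivial (temperedFrobenioidSmall R S).toElem A₀) (hA₀' : IG A₀.base)

/-- **THE FRACTION-PAIR OF THE THETA FUNCTION `Θ̈` at the junction carrier of record** (Def. 4.1 (i)), in EVERY canonical §4 instance over the
small-index model at `K : Type 0` (abc-iut-L2-t9's `mkOfModelCanonical`; verbatim at abc-iut-L2-t3's `settingSmall … M` / `settingSmallYdd …`):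
domain `(A, 0)`, codomain `(A, [ι D₁^{N_m}])`, `s′ = (1, id, ι zeros^{N_m}, Θ̈)`, `s″ = (1, id, ι poles^{N_m}, 1)`, disjoint supports PROVED — for
EVERY covering `A` with translation-free stabilisers (`hA`; at `A := Compat₃′/M`, `M ≤ Ker φ₃`, by `translationFree_repr_quotConnObj`).
[cite: MochizukiEtTh2009, Def 4.1 (i) p.86] -/
def thetaProperFractionPair :
    (BiKummerSetting.mkOfModelCanonical X (temperedFrobenioidSmall R S) rfl (hPSmall R S) IG gS gSs NH A₀ hA₀ hA₀').FractionPair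
      (A := AzeroSmall R S A) (thetaProperUnit R S A hA) (thetaProperCod R S A hA) where
  num := thetaProperNum R S A hA
  den := thetaProperDen R S A hA
  isPreStep_num := isPreStep_thetaProperNum R S A hA
  isPreStep_den := isPreStep_thetaProperDen R S A hA
  base_eq := baseEquivalent_thetaProperNum_thetaProperDen R S A hA
  frac_eq := fracOfModel_thetaProperNum_thetaProperDen R S A hA
  disjointSupports := fun x hx hx' => coprime_thetaZerosΦSmall_thetaPolesΦSmall R S A hA x hx hx'

/-- Its numerator is `s′`. [cite: MochizukiEtTh2009, Def 4.1 (i) p.86] -/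
@[simp] theorem thetaProperFractionPair_num :
    (thetaProperFractionPair R S A hA X IG gS gSs NH A₀ hA₀ hA₀').num = thetaProperNum R S A hA := rfl

/-- Its denominator is `s″`. [cite: MochizukiEtTh2009, Def 4.1 (i) p.86] -/
@[simp] theorem thetaProperFractionPair_den :
    (thetaProperFractionPair R S A hA X IG gS gSs NH A₀ hA₀ hA₀').den = thetaProperDen R S A hA := rfl

/-- Its zero divisor is the class of the cusps (to the `N_m`). [cite: MochizukiEtTh2009, Def 4.1 (i) p.87] -/
theorem thetaProperFractionPair_zeroDivisor :
    (thetaProperFractionPair R S A hA X IG gS gSs NH A₀ hA₀ hA₀').zeroDivisor = thetaZerosΦSmall R S A := div_thetaProperNum R S A hA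

/-- Its divisor of poles is the class of `D₁` (to the `N_m`). [cite: MochizukiEtTh2009, Def 4.1 (i) p.87] -/
theorem thetaProperFractionPair_poleDivisor :
    (thetaProperFractionPair R S A hA X IG gS gSs NH A₀ hA₀ hA₀').poleDivisor = thetaPolesΦSmall R S A hA := div_thetaProperDen R S A hA


/-! ## §4 At abc-iut-L2-t3's quotient sockets `settingSmall … M` (anchor `(Compat₃′/M, 0)`, `M ≤ Ker φ₃`) — named specialisations -/

section Quot

variable (φ : X.Pi →ₜ* Compat 3 thetaShear) (hφ : Function.Surjective φ) (M : OpenNormalSubgroup (Compat 3 thetaShear))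
  (hM : ∀ g ∈ M.toSubgroup, φ₃ g = 1)

/-- **`Θ̈ ∈ O^×(A_⊙^birat)` at the anchor `A_⊙ = (Compat₃′/M, 0)`** of `settingSmall … M` (`M ≤ Ker φ₃`; at `M := yddImage …` this is the Ÿ-anchor of
`settingSmallYdd`, the hypothesis being the display clause «`φ₃ ∘ φ ∘ ιX = 1` on `Π^tp_Ÿ`»). [cite: MochizukiEtTh2009, §5 p.330 (PDF p.104)] -/
def thetaProperUnitQuot : (temperedFrobenioidSmall R S).biratUnitsModel ((temperedFrobenioidSmall R S).quotConnZeroObj isTempered_compat₃' M) :=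
  thetaProperUnit R S (TemperedFrobenioid.quotConnObj isTempered_compat₃' M) (translationFree_repr_quotConnObj M hM)

/-- **The fraction-pair of `Θ̈` IN abc-iut-L2-t3's setting `settingSmall R S X φ hφ NH M`** (Def. 4.1 (i); `thetaProperFractionPair` read at the
anchor; nothing new). [cite: MochizukiEtTh2009, Def 4.1 (i) p.86] -/
def thetaProperFractionPairQuot :
    (settingSmall R S X φ hφ NH M).FractionPair (A := (temperedFrobenioidSmall R S).quotConnZeroObj isTempered_compat₃' M)
      (thetaProperUnitQuot R S M hM)
      (thetaProperCod R S (TemperedFrobenioid.quotConnObj isTempered_compat₃' M) (translationFree_repr_quotConnObj M hM)) :=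
  thetaProperFractionPair R S (TemperedFrobenioid.quotConnObj isTempered_compat₃' M) (translationFree_repr_quotConnObj M hM) X _ _ _ NH _
    ((temperedFrobenioidSmall R S).isFrobeniusTrivial_quotConnZeroObj isTempered_compat₃' M)
    ((temperedFrobenioidSmall R S).isGaloisObj_quotConnZeroObj_base isTempered_compat₃' M)

/-- Its numerator is `s′`. [cite: MochizukiEtTh2009, Def 4.1 (i) p.86] -/
@[simp] theorem thetaProperFractionPairQuot_num : (thetaProperFractionPairQuot R S X NH φ hφ M hM).num =
    thetaProperNum R S (TemperedFrobenioid.quotConnObj isTempered_compat₃' M) (translationFree_repr_quotConnObj M hM) := rfl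

/-- Its denominator is `s″`. [cite: MochizukiEtTh2009, Def 4.1 (i) p.86] -/
@[simp] theorem thetaProperFractionPairQuot_den : (thetaProperFractionPairQuot R S X NH φ hφ M hM).den =
    thetaProperDen R S (TemperedFrobenioid.quotConnObj isTempered_compat₃' M) (translationFree_repr_quotConnObj M hM) := rfl

end Quot

end ThetaTwistTowerSmallIndex

end Literature.AnabelianGeometry.EtaleTheta

end
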